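import Summits.Langlands.Langlands.Theses.RepeatedRootSocle

/-!
# Disproof attempt on `LimitClassicalUnrefinedR` (stmt-Langlands-18144) — findings: the crux SURVIVES

Crux-attack at birth (refuter `rattack-stmt-Langlands-18144`, 2026-08-17), route `RepeatedRootSocle`
(rev 5), decl `Summit.Langlands.Langlands.Theses.RepeatedRootSocle.LimitClassicalUnrefinedR` — the
REPAIRED heart (multiplier `ε`; byte-identical to the repair `LimitClassicalUnrefinedRepaired` proposed
in `Cruxes/LimitClassicalUnrefined/Disproof.lean` §2 by the seat that found the rev-≤4 decl vacuous).

Kernel-checked findings of this cycle (no `sorry`; nothing here asserts a Theses decl unconditionally):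

* §1 `lim_of_pure_of_aut` — inside the bracket the `p`-adic-limit hypothesis `Lim ρ` is implied by the
  conclusion `Aut ρ` together with `Pure ρ` (`ρ_m := ρ`, `P' := P ∈ ℤ[X] ⊆ 𝒪[X]`): the crux says exactly
  `Lim ρ ↔ Aut ρ` on irreducible symplectic-`ε` `P`-ordinary pure residually-big `ρ`; `Lim` is neither
  vacuous (it holds for every automorphic pure `ρ`) nor decoration (§3).
* §2 `limitClassicalUnrefinedR_of_aut_empty` — FAIL-SAFE direction of the interface test (A4): if the
  automorphic interface were EMPTY (no L-algebraic cuspidal `π` on `GL₄/ℚ` with a.e. Satake–Frobenius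
  matching for any `r`), `Lim ρ` is unsatisfiable (`m := 0`) and the crux holds VACUOUSLY — a junk /
  uninhabited `CuspidalAutomorphicRepData 4 ℚ hcpt` can make the crux true for the wrong reason, never
  false.  (Systemic to every lifting statement of the tree; recorded, not a defect of this item.)
* §3 `natCast_p_not_isUnit_valuedInteger`, `not_p_dvd_one` — `p` is a non-unit of
  `𝒪 = Valued.integer (PadicAlgCl p)` (`Valued.v p = 1/p`), so the congruences `p^m ∣ (P - P').coeff i`
  of `Lim` are stated in the valuation ring and are genuine constraints (in the FIELD they would be
  trivially true and `Lim` would collapse to "some automorphic `r'` has integral Frobenius polynomials").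
* §4 `limitClassicalUnrefinedR_of_langlands` — RESTATES-SUMMIT probe `S → C`: `Langlands` implies the
  crux MODULO the single literature bridge `OrdinaryShapeDeRham p` (Perrin-Riou 1994: an ordinary
  `p`-adic representation — here the Siegel `P`-ordinary shape `(εα, εβ | β⁻¹, α⁻¹)` of `PSh` — is
  semistable, hence de Rham; stated for the summit's PINNED Fontaine datum `ReciprocityData.pst`),
  and the derivation uses ONLY `Irreducible`, `PSh` (for de Rhamness) and `Pure` (a.e. unramified):
  `Sympl`, `BigRes`, `Lim` are not needed for TRUTH (`fmSector_of_langlands`,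
  `limitClassicalUnrefinedR_of_fmSector`) — they are load-bearing only for the intended PROOF
  (higher Hida theory / socle classicality).  Consequence: no refutation of the crux exists short of
  refuting the audited summit `Langlands` in the `GSp₄/ℚ` weight-2 ordinary sector or Perrin-Riou's
  theorem.  Probe `C → S`: not derivable (one sector of direction (B), `n = 4`, `F = ℚ`), not claimed.

Paper attacks (NOTES.md): vacuity — the bracket is consistent (`det = ε²` from `Sympl`, from `PSh`
(`repaired_det_consistent`, sibling workfile) and `det ρ(Frob_v) = q_v² = P(0) > 0` from `Pure`;
roots closed under `z ↦ q/z = z̄`), morally inhabited by `V_p(A)` of any modular ordinary abelian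
surface (`Lim` via §1), not constructible in the tree; degenerate parameters — `p = 2` excluded, finite
image impossible (`det = ε²`), reducible `ρ` excluded by hypothesis (load-bearing: for `ρ = ρ_{E₁} ⊕ ρ_{E₂}`
no CUSPIDAL `π` exists, Jacquet–Shalika); normalisation — `Aut` is verbatim the summit's
`SatakeFrobCompatibleAt` (L-algebraic `π = Π ⊗ |det|^{1/2}`, `|a_j| = q^{-1/2}`, arithmetic-Frobenius
roots `ι⁻¹(a_j⁻¹)` of modulus `q^{1/2}` = roots of the Weil polynomial `P`: consistent with `Pure`);
quantifier order as in the informal text (`Lim`'s exceptional set may depend on `m`, no level bound on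
`ρ_m`: weaker hypothesis, stronger — still FM-implied — crux); no finite model, no certified-compute
falsifier (interfaces not constructible; the new content is the char-0 repeated-root case
`P_p = (X² - tX + p)²`, `p ∤ t`, i.e. `t ∈ {±1, ±2}` at `p = 3`).  NON-EMPTINESS OF THE NEW CASE at
the level of reductions (local script `g2count.py`, exhaustive over the 1296 squarefree quintic /
sextic `f ∈ 𝔽₃[X]`): the ordinary repeated-root Weil polynomials `(X² ∓ 2X + 3)²`, `(X² ∓ X + 3)²`
(`(a₁,a₂) = (±4,10), (±2,7)`) are realised by `1, 1, 4, 4` models `y² = f(x)` over `𝔽₃`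
respectively, so genus-2 curves over `ℚ` with good ordinary reduction at `3` and `α = β` exist in
every residue class (lift `f`); the clause dropped from BCGP 2025 Thm 1.1 (3) is not void.
-/

set_option linter.dupNamespace false -- `Summit.Langlands.Langlands` is the mandated namespace (D-0017)

open scoped NumberField MatrixGroups Matrix Polynomial
open Field IsDedekindDomain Filter
open Literature.NumberTheory.GaloisRepresentations Literature.NumberTheory.Automorphic
open Summit.Langlands.Langlands.Theses.RepeatedRootSocle

noncomputable section

namespace Summit.Langlands.Langlands.Cruxes.LimitClassicalUnrefinedR.Disproof

variable {p : ℕ} [Fact p.Prime]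

/-! ## §0 The sub-formulas of the bracket, named (bodies verbatim from the route file) -/

/-- `Aut r` of the route file (verbatim): weak Satake automorphy on `GL₄/ℚ` — identical to the
summit's `SatakeFrobCompatibleAt` clause under `∃ π` L-algebraic cuspidal. [folklore] -/
def AutAt (hcpt : isCompact_glFiniteIntegralLevel 4 ℚ) (ι : PadicAlgCl p ≃+* ℂ)
    (r : FramedGaloisRep ℚ (PadicAlgCl p) 4) : Prop :=
  ∃ π : CuspidalAutomorphicRepData 4 ℚ hcpt, π.1.IsLAlgebraic ∧
    ∀ᶠ v : HeightOneSpectrum (𝓞 ℚ) in cofinite, ∃ a : Multiset ℂ, π.1.HasSatakeParamAt v a ∧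
      r.IsUnramifiedAt v ∧ r.HasFrobCharpolyAt v (arithFrobPolyOfSatake ι v.residueCard 1 a)

/-- `Pure r` of the route file (verbatim). [folklore] -/
def PureAt (r : FramedGaloisRep ℚ (PadicAlgCl p) 4) : Prop :=
  ∀ᶠ v : HeightOneSpectrum (𝓞 ℚ) in cofinite, r.IsUnramifiedAt v ∧ ∃ P : Polynomial ℤ,
    r.HasFrobCharpolyAt v (P.map (Int.castRingHom (PadicAlgCl p))) ∧
      ∀ z : ℂ, (P.map (Int.castRingHom ℂ)).IsRoot z → ‖z‖ ^ 2 = (v.residueCard : ℝ)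

/-- `Lim r` of the route file (verbatim): `r` is a `p`-adic limit of automorphic representations. [folklore] -/
def LimAt (hcpt : isCompact_glFiniteIntegralLevel 4 ℚ) (ι : PadicAlgCl p ≃+* ℂ)
    (r : FramedGaloisRep ℚ (PadicAlgCl p) 4) : Prop :=
  ∀ m : ℕ, ∃ r' : FramedGaloisRep ℚ (PadicAlgCl p) 4, AutAt hcpt ι r' ∧
    ∀ᶠ v : HeightOneSpectrum (𝓞 ℚ) in cofinite,
      ∃ P P' : Polynomial (Valued.integer (PadicAlgCl p)),
        r.HasFrobCharpolyAt v (P.map (Valued.integer (PadicAlgCl p)).subtype) ∧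
        r'.HasFrobCharpolyAt v (P'.map (Valued.integer (PadicAlgCl p)).subtype) ∧
        ∀ i : ℕ, ((p : ℕ) : Valued.integer (PadicAlgCl p)) ^ m ∣ (P - P').coeff i

/-- `PSh r v` of the route file (verbatim): Siegel-parabolic weight-2 ordinary shape at `v`,
homological convention, NO distinctness of `α`, `β`. [folklore] -/
def PShAt (r : FramedGaloisRep ℚ (PadicAlgCl p) 4) (v : HeightOneSpectrum (𝓞 ℚ)) : Prop :=
  ∃ (g : Matrix.GeneralLinearGroup (Fin 4) (PadicAlgCl p))
    (α β : absoluteGaloisGroup (v.adicCompletion ℚ) →* (PadicAlgCl p)ˣ),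
    (∀ τ ∈ absInertia (v.adicCompletion ℚ), α τ = 1 ∧ β τ = 1) ∧
    ∀ τ, (∀ i j : Fin 4, j < i → (g⁻¹ * r.toLocal v τ * g).val i j = 0) ∧
      (g⁻¹ * r.toLocal v τ * g).val 0 1 = 0 ∧ (g⁻¹ * r.toLocal v τ * g).val 2 3 = 0 ∧
      (g⁻¹ * r.toLocal v τ * g).val 0 0 =
        algebraMap ℚ_[p] (PadicAlgCl p)
          (((GaloisRep.cyclotomicCharacter (v.adicCompletion ℚ) p τ : ℤ_[p]ˣ) : ℤ_[p]) : ℚ_[p]) *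
          α τ ∧
      (g⁻¹ * r.toLocal v τ * g).val 1 1 =
        algebraMap ℚ_[p] (PadicAlgCl p)
          (((GaloisRep.cyclotomicCharacter (v.adicCompletion ℚ) p τ : ℤ_[p]ˣ) : ℤ_[p]) : ℚ_[p]) *
          β τ ∧
      (g⁻¹ * r.toLocal v τ * g).val 2 2 = ((β τ)⁻¹ : (PadicAlgCl p)ˣ) ∧
      (g⁻¹ * r.toLocal v τ * g).val 3 3 = ((α τ)⁻¹ : (PadicAlgCl p)ˣ)

/-! ## §1 `Lim` is implied by the conclusion (plus `Pure`): no vacuity from `Lim` -/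

/-- **`Pure ρ → Aut ρ → Lim ρ`**: an automorphic `ρ` with integral (`ℤ`-) Frobenius polynomials a.e.
is trivially a `p`-adic limit of automorphic representations (`ρ_m := ρ`, `P' := P`).  So inside the
bracket the crux asserts `Lim ρ ↔ Aut ρ`; in particular `Lim ρ` holds for `V_p(A)` of every modular
ordinary abelian surface (the bracket is morally inhabited). [folklore] -/
theorem lim_of_pure_of_aut {hcpt : isCompact_glFiniteIntegralLevel 4 ℚ} (ι : PadicAlgCl p ≃+* ℂ)
    (ρ : FramedGaloisRep ℚ (PadicAlgCl p) 4) (hpure : PureAt ρ) (haut : AutAt hcpt ι ρ) :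
    LimAt hcpt ι ρ := by
  intro m
  refine ⟨ρ, haut, hpure.mono ?_⟩
  rintro v ⟨-, P, hP, -⟩
  have hc : ((Valued.integer (PadicAlgCl p)).subtype.comp
      (Int.castRingHom (Valued.integer (PadicAlgCl p)))) = Int.castRingHom (PadicAlgCl p) :=
    RingHom.ext_int _ _
  have hP' : ρ.HasFrobCharpolyAt v ((P.map (Int.castRingHom (Valued.integer (PadicAlgCl p)))).map
      (Valued.integer (PadicAlgCl p)).subtype) := by
    rwa [Polynomial.map_map, hc]
  exact ⟨_, _, hP', hP', fun i => by simp⟩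

/-! ## §2 Fail-safe: an EMPTY automorphic interface makes the crux vacuously true (never false) -/

/-- **A4 junk-interface test, fail-safe direction.**  If for no `p`, level datum, `ι` and no `r` the
automorphic clause `Aut r` is satisfiable (e.g. if `CuspidalAutomorphicRepData 4 ℚ hcpt` had no
L-algebraic member with Satake parameters a.e.), then `Lim ρ` fails at `m = 0` and
`LimitClassicalUnrefinedR` holds VACUOUSLY.  Recorded so that nobody mistakes such a proof for
content: the crux can be true for the wrong reason in a junk world, but cannot be REFUTED through
the automorphic interface. [folklore] -/
theorem limitClassicalUnrefinedR_of_aut_empty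
    (hempty : ∀ (p : ℕ) [Fact p.Prime] (hcpt : isCompact_glFiniteIntegralLevel 4 ℚ)
      (ι : PadicAlgCl p ≃+* ℂ) (r : FramedGaloisRep ℚ (PadicAlgCl p) 4), ¬ AutAt hcpt ι r) :
    LimitClassicalUnrefinedR := by
  intro p _ _ k _ _ _ _ _ red hcpt ι
  dsimp only
  intro ρ _ _ _ _ _ hlim
  obtain ⟨r', hA, -⟩ := hlim 0
  exact (hempty p hcpt ι r' hA).elim

/-! ## §3 `Lim`'s congruences live in the valuation ring: `p` is a non-unit there -/

/-- `p` is NOT a unit of `𝒪 = Valued.integer (PadicAlgCl p)` (`Valued.v p = 1/p < 1`), so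
`p ^ m ∣ x` in `𝒪` is a genuine congruence. [folklore] -/
theorem natCast_p_not_isUnit_valuedInteger :
    ¬ IsUnit ((p : ℕ) : Valued.integer (PadicAlgCl p)) := by
  intro hu
  have hp : p.Prime := Fact.out
  have h1 : Valued.v (((p : ℕ) : Valued.integer (PadicAlgCl p)) : PadicAlgCl p) = 1 :=
    Valuation.Integers.one_of_isUnit (Valuation.integer.integers _) hu
  have h2 : (((p : ℕ) : Valued.integer (PadicAlgCl p)) : PadicAlgCl p) = (p : PadicAlgCl p) := by
    simp
  rw [h2, PadicAlgCl.valuation_p p] at h1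
  have h3 : (p : NNReal) = 1 := by
    have hp0 : (p : NNReal) ≠ 0 := by exact_mod_cast hp.ne_zero
    field_simp at h1
    simpa using h1.symm
  have : p = 1 := by exact_mod_cast h3
  exact hp.one_lt.ne' this

/-- … hence already `p ^ 1 ∤ 1` in `𝒪`: the `m`-th congruence of `Lim` is not decoration (in the
field `PadicAlgCl p` every `p ^ m ∣ x` would hold). [folklore] -/
theorem not_p_pow_one_dvd_one :
    ¬ ((p : ℕ) : Valued.integer (PadicAlgCl p)) ^ 1 ∣ 1 := by
  rw [pow_one]
  exact fun h => natCast_p_not_isUnit_valuedInteger (isUnit_of_dvd_one h)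

/-! ## §4 Restates-summit probe `S → C`: the crux is `Langlands`-implied modulo Perrin-Riou -/

/-- **The Perrin-Riou bridge** (HYPOTHESIS of the probe, not asserted): a framed
`ρ : Γ_ℚ → GL₄(ℚ̄_p)` of Siegel `P`-ordinary shape at `v ∣ p` (`PSh`: filtration with graded pieces
`ε ⊗ (α ⊕ β)` and `β⁻¹ ⊕ α⁻¹`, `α, β` unramified — an ORDINARY representation) is de Rham for the
summit's PINNED Fontaine datum `ReciprocityData.pst` (ordinary ⇒ semistable ⇒ de Rham).
[cite: PerrinRiou1994Ordinaires, Théorème 1.5] [topic: NumberTheory/PAdicHodge] -/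
def OrdinaryShapeDeRham (p : ℕ) [Fact p.Prime] : Prop :=
  ∀ (𝓡 : Summit.Langlands.ReciprocityData ℚ) (ρ : FramedGaloisRep ℚ (PadicAlgCl p) 4)
    (v : HeightOneSpectrum (𝓞 ℚ)) (hv : ((p : ℕ) : 𝓞 ℚ) ∈ v.asIdeal),
    PShAt ρ v → (𝓡.pst p v hv).IsDeRhamFramed (ρ.toLocal v)

/-- The Fontaine–Mazur–Langlands statement of the SECTOR with `Sympl`, `BigRes`, `Lim` DROPPED:
irreducible + `P`-ordinary shape above `p` + pure a.e. ⟹ weakly automorphic.  (Mutation target: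
it still follows from the summit, §4.) [folklore] -/
def FMSector : Prop :=
  ∀ (p : ℕ) [Fact p.Prime], p ≠ 2 → ∀ (hcpt : isCompact_glFiniteIntegralLevel 4 ℚ)
    (ι : PadicAlgCl p ≃+* ℂ) (ρ : FramedGaloisRep ℚ (PadicAlgCl p) 4),
    ρ.toGaloisRep.IsIrreducible →
    (∀ v : HeightOneSpectrum (𝓞 ℚ), ((p : ℕ) : 𝓞 ℚ) ∈ v.asIdeal → PShAt ρ v) →
    PureAt ρ → AutAt hcpt ι ρ

/-- **`Langlands` ⟹ the sector statement without `Sympl`/`BigRes`/`Lim`**, modulo the Perrin-Riou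
bridge: direction (B) of the summit at `n = 4`, `F = ℚ`, `ℓ = p`, with geometricity assembled from
`Pure` (a.e. unramified) and the bridge (de Rham above `p`); the Satake clause of `Corresponds` is
verbatim `Aut`. [folklore] -/
theorem fmSector_of_langlands (hdR : ∀ (p : ℕ) [Fact p.Prime], OrdinaryShapeDeRham p)
    (hL : _root_.Langlands) : FMSector := by
  intro p _ _ hcpt ι ρ hirr hsh hpure
  obtain ⟨⟨𝓡⟩, hcorr⟩ := hL ℚ
  have hgeom : Summit.Langlands.IsGeometricFramed 𝓡 ρ :=
    ⟨hpure.mono fun v hv => hv.1, fun v hv => hdR p 𝓡 ρ v hv (hsh v hv)⟩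
  obtain ⟨π, hLalg, hcor⟩ := (hcorr 𝓡 4 (by norm_num) hcpt).2 p ι ρ hirr hgeom
  exact ⟨π, hLalg, hcor.1⟩

/-- The mutated statement implies the crux (the dropped hypotheses are simply not used). [folklore] -/
theorem limitClassicalUnrefinedR_of_fmSector (h : FMSector) : LimitClassicalUnrefinedR := by
  intro p _ hp k _ _ _ _ _ red hcpt ι
  dsimp only
  intro ρ hirr _ hsh hpure _ _
  exact h p hp hcpt ι ρ hirr hsh hpure

/-- **Probe `S → C`**: `Langlands → LimitClassicalUnrefinedR` modulo the Perrin-Riou bridge.  Hence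
the crux admits no refutation short of `¬ Langlands` (in this sector) or `¬ OrdinaryShapeDeRham`.
[folklore] -/
theorem limitClassicalUnrefinedR_of_langlands (hdR : ∀ (p : ℕ) [Fact p.Prime], OrdinaryShapeDeRham p)
    (hL : _root_.Langlands) : LimitClassicalUnrefinedR :=
  limitClassicalUnrefinedR_of_fmSector (fmSector_of_langlands hdR hL)

/-- Contrapositive bookkeeping: a refutation of the crux refutes `Langlands` or the bridge. [folklore] -/
theorem not_langlands_or_not_bridge_of_not_crux (h : ¬ LimitClassicalUnrefinedR) :
    ¬ _root_.Langlands ∨ ¬ ∀ (p : ℕ) [Fact p.Prime], OrdinaryShapeDeRham p := by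
  by_cases hL : _root_.Langlands
  · exact Or.inr fun hdR => h (limitClassicalUnrefinedR_of_langlands hdR hL)
  · exact Or.inl hL

end Summit.Langlands.Langlands.Cruxes.LimitClassicalUnrefinedR.Disproof

end
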